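import Summits.CriticalPhenomena.PercolationContinuityZ3.Theorems.PercNearOneGluingNoHeavyLowerTailHullPortTANWithinDefs
import Summits.CriticalPhenomena.PercolationContinuityZ3.Theorems.PercNearOneGluingNoHeavyLowerTailHullPortTANInduction
import Literature.Probability.Percolation.LonePortSumGeneral
import HarnessLib

/-!
# `NoHeavyLowerTail` (stmt-CriticalPhenomena-4575) — set-observer marker dominance: conditioning identities for `ζ̄_N`

Support file (prover `prim-hp-7`; `--supports stmt-CriticalPhenomena-4575`); no definitions, named facts or sorries.
Blueprint steps B3–B4 (prim-cplus-coupling A5-COUPLING-gen13.md §4 (4c)–(4d); prim-hp-7 FROM-prim-hp-7-g29-REFEREE-MDLSET.md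
§2) of the set-observer marker dominance lemma (towards Kozma–Nitzan's Question 9 at `|A| = 3`), part 1: the three
conditioning facts about the test variable `ζ_N = 1{s ↔ N}·1{N ↮ X} = 1{C_s ∈ hitN s N}·1{C_X ∈ missN N X}` and its
`σ(C_s)`-conditional expectation `ζ̄_N = zetaBarN` (definitions `…HullPortTANWithinDefs`), all as exact finite-sum
statements in BHK's two-cluster bookkeeping (`condS`, `gibbsT` of `TwoClusterGibbsCovariance.lean`; `D = {s ↮ X}`):
* `HullPort.zetaN_towerS` — (I) tower along `σ(C_s)`: `E[φ(C_s) ζ_N; D] = E[φ(C_s) ζ̄_N(C_s); D]` (BHK display (10):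
  given `C_s` the configuration off `C̄_s` is fresh; on `D` the event `{N ↮ X}` is read off `C̄_s`);
* `HullPort.zetaN_condX` — (II) conditioning on `σ(C_X)`: `E[ψ(C_s) k(C_X); D] = E[k(C_X) (Aψ)(C_X); D]`,
  `(Aψ)(B) = condS ψ B` (BHK Lemma 2.4, `set_sum_cond_cluster'`);
* `HullPort.zetaN_harrisS` — (III) Harris off `C̄_s`: `E[(𝑇g)(C_s) ζ̄_N(C_s); D] ≤ E[(Ag)(C_X) ζ_N; D]` for monotone `g`
  (`(Ag)(C_X(η))` and `1{N ↮ X}(η)` are both decreasing in the fresh configuration `η` off `C̄_s`).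
[cite: VandenbergHaggstromKahn2005, §1 pp. 6–8 (Harris; display (10)), §2.1 Lemma 2.4 (p. 10), Remark 2.8 (p. 12)]
-/

noncomputable section

namespace Summit.CriticalPhenomena.PercolationContinuityZ3.Theorems

open MeasureTheory Set Literature.Probability.LatticeModels Literature.Probability.Percolation
open scoped Classical

variable {V : Type*}

namespace HullPort

open LonePortSum LonePortSumGeneral BHK2006 DecisionTree KNPreFKG

section TANWithin

variable [Fintype V]

/-! ### Reading the indicators -/

omit [Fintype V] in
/-- `C_X(ω) ∈ missN N X ↔ N ↮ X`. [folklore] -/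
theorem ind_missN_setCl (N X : Set V) (ω : Set (Sym2 V)) :
    ind (missN N X) (setCl ω X) = ind (sepEv N X) ω := by
  have key : setCl ω X ∈ missN N X ↔ ω ∈ sepEv N X := by
    simp only [missN, sepEv, Set.mem_setOf_eq]
    constructor
    · intro h n hn t ht hr
      exact h n hn ((setReach_iff ω X n).1 ⟨t, ht, hr.symm⟩)
    · intro h n hn hmem
      obtain ⟨t, ht, hr⟩ := (setReach_iff ω X n).2 hmem
      exact h n hn t ht hr.symm
  by_cases h : ω ∈ sepEv N X
  · rw [ind_of_mem h, ind_of_mem (key.2 h)]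
  · rw [ind_of_not_mem h, ind_of_not_mem fun h' => h (key.1 h')]

omit [Fintype V] in
/-- `cut X ω ∈ avoidCut N ↔ N ↮ X`. [folklore] -/
theorem ind_avoidCut_cut (N X : Set V) (ω : Set (Sym2 V)) :
    ind (avoidCut N) (cut X ω) = ind (sepEv N X) ω := by
  have key : cut X ω ∈ avoidCut N ↔ ω ∈ sepEv N X := by
    simp only [avoidCut, cut, sepEv, Set.mem_setOf_eq]
    constructor
    · intro h n hn t ht hr
      exact h n hn ⟨n, Sym2.mem_mk_left _ _, t, ht, hr.symm⟩
    · rintro h n hn ⟨v, hv, t, ht, hr⟩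
      have hvn : v = n := by
        rcases Sym2.mem_iff.1 hv with rfl | rfl <;> rfl
      subst hvn
      exact h v hn t ht hr.symm
  by_cases h : ω ∈ sepEv N X
  · rw [ind_of_mem h, ind_of_mem (key.2 h)]
  · rw [ind_of_not_mem h, ind_of_not_mem fun h' => h (key.1 h')]

omit [Fintype V] in
/-- `C_s(ω) ∈ hitN s N ↔ s ↔ N`. [folklore] -/
theorem ind_hitN_openEdgeCluster (s : V) (N : Set V) (ω : Set (Sym2 V)) :
    ind (hitN s N) (openEdgeCluster ω s) = ind (connS N s) ω := by
  have key : openEdgeCluster ω s ∈ hitN s N ↔ ω ∈ connS N s := by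
    simp only [hitN, connS, Set.mem_setOf_eq]
    constructor
    · rintro ⟨n, hn, h⟩
      exact ⟨n, hn, (reachable_iff_exists_mem_openEdgeCluster ω s n).2 h⟩
    · rintro ⟨n, hn, h⟩
      exact ⟨n, hn, (reachable_iff_exists_mem_openEdgeCluster ω s n).1 h⟩
  by_cases h : ω ∈ connS N s
  · rw [ind_of_mem h, ind_of_mem (key.2 h)]
  · rw [ind_of_not_mem h, ind_of_not_mem fun h' => h (key.1 h')]

omit [Fintype V] in
/-- `1_{s ↮ X}` read on `C_s`. [folklore] -/
theorem ind_avoidEv_eq_cluster (s : V) (X : Set V) (ω : Set (Sym2 V)) :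
    ind (avoidEv s X) ω = ind {A : Set (Sym2 V) | ∀ x ∈ X, ¬ (x = s ∨ ∃ e ∈ A, x ∈ e)} (openEdgeCluster ω s) := by
  have key : ω ∈ avoidEv s X ↔
      openEdgeCluster ω s ∈ {A : Set (Sym2 V) | ∀ x ∈ X, ¬ (x = s ∨ ∃ e ∈ A, x ∈ e)} := by
    simp only [avoidEv, Set.mem_setOf_eq]
    exact forall₂_congr fun x _ => not_congr (reachable_iff_exists_mem_openEdgeCluster ω s x)
  by_cases h : ω ∈ avoidEv s X
  · rw [ind_of_mem h, ind_of_mem (key.1 h)]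
  · rw [ind_of_not_mem h, ind_of_not_mem fun h' => h (key.2 h')]

omit [Fintype V] in
/-- **Locality of `{N ↮ X}` on `{s ↮ X}`**: the event is read on the configuration off `C̄_s`. [folklore] -/
theorem ind_sepEv_sdiff_bar (s : V) (N X : Set V) (ω : Set (Sym2 V)) (hω : ω ∈ avoidEv s X) :
    ind (sepEv N X) (ω \ {e | ∃ v ∈ e, v = s ∨ ∃ e' ∈ openEdgeCluster ω s, v ∈ e'}) = ind (sepEv N X) ω := by
  have key : (ω \ {e | ∃ v ∈ e, v = s ∨ ∃ e' ∈ openEdgeCluster ω s, v ∈ e'}) ∈ sepEv N X ↔ ω ∈ sepEv N X := by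
    simp only [sepEv, Set.mem_setOf_eq]
    refine forall₂_congr fun n _ => forall₂_congr fun t ht => not_congr ?_
    rw [SimpleGraph.reachable_comm, reachable_sdiff_bar_iff (hω t ht) n, SimpleGraph.reachable_comm]
  by_cases h : ω ∈ sepEv N X
  · rw [ind_of_mem h, ind_of_mem (key.2 h)]
  · rw [ind_of_not_mem h, ind_of_not_mem fun h' => h (key.1 h')]

omit [Fintype V] in
/-- `barOf {s} A` is the set of pairs meeting `{s} ∪ V(A)`. [folklore] -/
theorem barOf_singleton_eq (s : V) (A : Set (Sym2 V)) :
    barOf {s} A = {e | ∃ v ∈ e, v = s ∨ ∃ e' ∈ A, v ∈ e'} := by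
  ext e
  simp only [mem_barOf_iff, Set.mem_singleton_iff, Set.mem_setOf_eq]

omit [Fintype V] in
/-- On `{s ↮ X}` the cluster of `X` is read off `C̄_s`. [cite: VandenbergHaggstromKahn2005, §2.1 Lemma 2.3 (p. 10)] -/
theorem setCl_eq_sdiff_bar_of_avoid (s : V) (X : Set V) (ω : Set (Sym2 V)) (hω : ω ∈ avoidEv s X) :
    setCl ω X = setCl (ω \ {e | ∃ v ∈ e, v = s ∨ ∃ e' ∈ openEdgeCluster ω s, v ∈ e'}) X := by
  have hT : ∀ t ∈ X, ¬ (t ∈ ({s} : Set V) ∨ ∃ e ∈ openEdgeCluster ω s, t ∈ e) := by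
    intro t ht h
    rw [Set.mem_singleton_iff] at h
    exact hω t ht ((reachable_iff_exists_mem_openEdgeCluster ω s t).2 h)
  have key := setCl_eq_sdiff_barOf (S := {s}) (T := X) (setCl_singleton ω s) hT
  rw [barOf_singleton_eq] at key
  exact key

omit [Fintype V] in
/-- `D = {s ↮ X}` in the two-set form. [folklore] -/
theorem mem_avoidEv_iff_two (s : V) (X : Set V) (ω : Set (Sym2 V)) :
    ω ∈ avoidEv s X ↔ ∀ s' ∈ ({s} : Set V), ∀ t ∈ X, ¬ (openGraph ω).Reachable s' t := by
  simp only [avoidEv, Set.mem_setOf_eq, Set.mem_singleton_iff, forall_eq]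

/-! ### (I) The tower property along `σ(C_s)` -/

/-- **(I)** `Σ_ω w φ(C_s) 1{C_s ∈ hitN} 1{C_X ∈ missN} 1_D = Σ_ω w φ(C_s) ζ̄_N(C_s) 1_D`.
[cite: VandenbergHaggstromKahn2005, §1 pp. 7–8 (display (10)) — corollary] -/
theorem zetaN_towerS (p : Sym2 V → unitInterval) (s : V) (N X : Set V) (φ : Set (Sym2 V) → ℝ) :
    ∑ ω, weight (fun e => (p e : ℝ)) ω * (φ (openEdgeCluster ω s) *
        (ind (hitN s N) (openEdgeCluster ω s) * ind (missN N X) (setCl ω X)) * ind (avoidEv s X) ω) =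
      ∑ ω, weight (fun e => (p e : ℝ)) ω * (φ (openEdgeCluster ω s) *
        zetaBarN (fun e => (p e : ℝ)) s N X (openEdgeCluster ω s) * ind (avoidEv s X) ω) := by
  classical
  set w : Sym2 V → ℝ := fun e => (p e : ℝ) with hw
  have hm : ∑ ω, weight w ω = 1 := by
    have h1 := integral_prodBernoulli_eq_sum p fun _ => (1 : ℝ)
    simp only [integral_const, probReal_univ, smul_eq_mul, mul_one] at h1
    exact h1.symm
  set K : Set (Sym2 V) → Set (Sym2 V) → ℝ := fun A ξ =>
    φ A * ind (hitN s N) A * ind {A : Set (Sym2 V) | ∀ x ∈ X, ¬ (x = s ∨ ∃ e ∈ A, x ∈ e)} A *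
      ind (sepEv N X) ξ with hK
  have lhs : ∀ ω : Set (Sym2 V), weight w ω * (φ (openEdgeCluster ω s) *
      (ind (hitN s N) (openEdgeCluster ω s) * ind (missN N X) (setCl ω X)) * ind (avoidEv s X) ω) =
      weight w ω * K (openEdgeCluster ω s) (ω \ {e | ∃ v ∈ e, v = s ∨ ∃ e' ∈ openEdgeCluster ω s, v ∈ e'}) := by
    intro ω
    simp only [hK]
    rw [← ind_avoidEv_eq_cluster s X ω, ind_missN_setCl]
    by_cases hω : ω ∈ avoidEv s X
    · rw [ind_sepEv_sdiff_bar s N X ω hω, ind_of_mem hω]; ring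
    · rw [ind_of_not_mem hω]; ring
  have rhs : ∀ ω : Set (Sym2 V), weight w ω * (φ (openEdgeCluster ω s) *
      zetaBarN w s N X (openEdgeCluster ω s) * ind (avoidEv s X) ω) =
      weight w ω * ∑ η, weight w η *
        K (openEdgeCluster ω s) (η \ {e | ∃ v ∈ e, v = s ∨ ∃ e' ∈ openEdgeCluster ω s, v ∈ e'}) := by
    intro ω
    simp only [hK]
    rw [← ind_avoidEv_eq_cluster s X ω, zetaBarN]
    have h1 : ∑ η, weight w η * (φ (openEdgeCluster ω s) * ind (hitN s N) (openEdgeCluster ω s) *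
        ind (avoidEv s X) ω *
          ind (sepEv N X) (η \ {e | ∃ v ∈ e, v = s ∨ ∃ e' ∈ openEdgeCluster ω s, v ∈ e'})) =
        (φ (openEdgeCluster ω s) * ind (hitN s N) (openEdgeCluster ω s) * ind (avoidEv s X) ω) *
          ∑ η, weight w η * ind (sepEv N X) (η \ {e | ∃ v ∈ e, v = s ∨ ∃ e' ∈ openEdgeCluster ω s, v ∈ e'}) := by
      rw [Finset.mul_sum]
      exact Finset.sum_congr rfl fun η _ => by ring
    rw [h1]; ring
  rw [Finset.sum_congr rfl fun ω _ => lhs ω, Finset.sum_congr rfl fun ω _ => rhs ω]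
  exact sum_cond_cluster_sdiff w hm s K

/-! ### (II) Conditioning on `σ(C_X)` -/

/-- **(II)** `Σ_ω w ψ(C_s) k(C_X) 1_D = Σ_ω w k(C_X) (Aψ)(C_X) 1_D`, `(Aψ)(B) = condS w {s} X ψ B`.
[cite: VandenbergHaggstromKahn2005, §2.1 Lemma 2.4 (p. 10) — corollary] -/
theorem zetaN_condX (p : Sym2 V → unitInterval) (s : V) (X : Set V) (ψ k : Set (Sym2 V) → ℝ) :
    ∑ ω, weight (fun e => (p e : ℝ)) ω * (ψ (openEdgeCluster ω s) * k (setCl ω X) * ind (avoidEv s X) ω) =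
      ∑ ω, weight (fun e => (p e : ℝ)) ω *
        (k (setCl ω X) * condS (fun e => (p e : ℝ)) {s} X ψ (setCl ω X) * ind (avoidEv s X) ω) := by
  classical
  set w : Sym2 V → ℝ := fun e => (p e : ℝ) with hw
  have hm : ∑ ω, weight w ω = 1 := by
    have h1 := integral_prodBernoulli_eq_sum p fun _ => (1 : ℝ)
    simp only [integral_const, probReal_univ, smul_eq_mul, mul_one] at h1
    exact h1.symm
  have key := set_sum_cond_cluster' w hm {s} X (fun A B => ψ A * k B) (D := avoidEv s X)
    (mem_avoidEv_iff_two s X)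
  simp only [setCl_singleton] at key
  rw [key]
  refine Finset.sum_congr rfl fun ω _ => ?_
  have h1 : ∑ η, weight w η * (ψ (openEdgeCluster (η \ barOf X (setCl ω X)) s) * k (setCl ω X)) =
      k (setCl ω X) * condS w {s} X ψ (setCl ω X) := by
    rw [condS, Finset.mul_sum]
    refine Finset.sum_congr rfl fun η _ => ?_
    simp only [halfS, setCl_singleton]
    ring
  rw [h1]

/-! ### (III) Harris off `C̄_s` -/

/-- **(III)** For monotone `g`: `Σ_ω w (𝑇g)(C_s) ζ̄_N(C_s) 1_D ≤ Σ_ω w (Ag)(C_X) 1{C_s ∈ hitN} 1{C_X ∈ missN} 1_D`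
— given `C_s`, `(Ag)(C_X(η))` and `1{N ↮ X}(η)` are decreasing functions of the fresh configuration `η` off `C̄_s`
(Harris), and `Σ_η w(η) (Ag)(C_X(η ∖ C̄_s)) = (𝑇g)(C_s)`.
[cite: VandenbergHaggstromKahn2005, §1 pp. 6–8 (Harris; display (10)), §2.1 Remark 2.8 (p. 12) — corollary] -/
theorem zetaN_harrisS (p : Sym2 V → unitInterval) (s : V) (N X : Set V) (g : Set (Sym2 V) → ℝ) (hg : Monotone g) :
    ∑ ω, weight (fun e => (p e : ℝ)) ω * (gibbsT (fun e => (p e : ℝ)) {s} X g (openEdgeCluster ω s) *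
        zetaBarN (fun e => (p e : ℝ)) s N X (openEdgeCluster ω s) * ind (avoidEv s X) ω) ≤
      ∑ ω, weight (fun e => (p e : ℝ)) ω * (condS (fun e => (p e : ℝ)) {s} X g (setCl ω X) *
        (ind (hitN s N) (openEdgeCluster ω s) * ind (missN N X) (setCl ω X)) * ind (avoidEv s X) ω) := by
  classical
  set w : Sym2 V → ℝ := fun e => (p e : ℝ) with hw
  have hw0 : ∀ e, 0 ≤ w e := fun e => (p e).2.1
  have hw1 : ∀ e, w e ≤ 1 := fun e => (p e).2.2
  have hm : ∑ ω, weight w ω = 1 := by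
    have h1 := integral_prodBernoulli_eq_sum p fun _ => (1 : ℝ)
    simp only [integral_const, probReal_univ, smul_eq_mul, mul_one] at h1
    exact h1.symm
  set K : Set (Sym2 V) → Set (Sym2 V) → ℝ := fun A ξ =>
    ind {A : Set (Sym2 V) | ∀ x ∈ X, ¬ (x = s ∨ ∃ e ∈ A, x ∈ e)} A * ind (hitN s N) A *
      (condS w {s} X g (setCl ξ X) * ind (sepEv N X) ξ) with hK
  -- the right-hand side as `Σ_ω w K(C_s, ω ∖ C̄_s)`, then display (10)
  have rhs : ∀ ω : Set (Sym2 V), weight w ω * (condS w {s} X g (setCl ω X) *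
      (ind (hitN s N) (openEdgeCluster ω s) * ind (missN N X) (setCl ω X)) * ind (avoidEv s X) ω) =
      weight w ω * K (openEdgeCluster ω s) (ω \ {e | ∃ v ∈ e, v = s ∨ ∃ e' ∈ openEdgeCluster ω s, v ∈ e'}) := by
    intro ω
    simp only [hK]
    rw [← ind_avoidEv_eq_cluster s X ω, ind_missN_setCl]
    by_cases hω : ω ∈ avoidEv s X
    · rw [ind_sepEv_sdiff_bar s N X ω hω, ind_of_mem hω, ← setCl_eq_sdiff_bar_of_avoid s X ω hω]; ring
    · rw [ind_of_not_mem hω]; ring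
  rw [Finset.sum_congr rfl fun ω _ => rhs ω, sum_cond_cluster_sdiff w hm s K]
  refine Finset.sum_le_sum fun ω _ => mul_le_mul_of_nonneg_left ?_ (weight_nonneg hw0 hw1 ω)
  set B : Set (Sym2 V) := {e | ∃ v ∈ e, v = s ∨ ∃ e' ∈ openEdgeCluster ω s, v ∈ e'} with hB
  -- inner Harris: both `η ↦ (Ag)(C_X(η ∖ B))` and `η ↦ 1{N ↮ X}(η ∖ B)` are antitone
  have hf : Antitone fun η : Set (Sym2 V) => condS w {s} X g (setCl (η \ B) X) := fun η η' h =>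
    condS_antitone hw0 hw1 {s} X hg (setCl_mono (Set.sdiff_subset_sdiff_left h) X)
  have hG : Antitone fun η : Set (Sym2 V) => ind (sepEv N X) (η \ B) := fun η η' h =>
    ind_anti_of_isLowerSet (isLowerSet_sepEv N X) (Set.sdiff_subset_sdiff_left h)
  have hgle : ∀ C, g C ≤ g Set.univ := fun C => hg (Set.subset_univ C)
  have hfM : ∀ η : Set (Sym2 V), condS w {s} X g (setCl (η \ B) X) ≤ g Set.univ := by
    intro η
    calc condS w {s} X g (setCl (η \ B) X) ≤ ∑ ζ, weight w ζ * g Set.univ :=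
          Finset.sum_le_sum fun ζ _ => mul_le_mul_of_nonneg_left (hgle _) (weight_nonneg hw0 hw1 ζ)
      _ = g Set.univ := by rw [← Finset.sum_mul, hm, one_mul]
  have hGM : ∀ η : Set (Sym2 V), ind (sepEv N X) (η \ B) ≤ 1 := fun η => ind_le_one _ _
  have hH := harris_anti_anti hw0 hw1 hm hf hG hfM hGM
  -- `Σ_η w (Ag)(C_X(η ∖ B)) = (𝑇g)(C_s ω)`
  have hT : ∑ η, weight w η * condS w {s} X g (setCl (η \ B) X) = gibbsT w {s} X g (openEdgeCluster ω s) := by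
    simp only [gibbsT, halfT, barOf_singleton_eq, hB]
  -- `1{C_s ∈ hitN} Σ_η w 1{N↮X}(η ∖ B) = ζ̄_N(C_s ω)`
  have hZ : ind (hitN s N) (openEdgeCluster ω s) * ∑ η, weight w η * ind (sepEv N X) (η \ B) =
      zetaBarN w s N X (openEdgeCluster ω s) := by
    simp only [zetaBarN, hB]
  have hNX0 : 0 ≤ ind (avoidEv s X) ω := ind_nonneg _ _
  have hh0 : 0 ≤ ind (hitN s N) (openEdgeCluster ω s) := ind_nonneg _ _
  have lhs_eq : gibbsT w {s} X g (openEdgeCluster ω s) * zetaBarN w s N X (openEdgeCluster ω s) *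
      ind (avoidEv s X) ω =
      ind (avoidEv s X) ω * ind (hitN s N) (openEdgeCluster ω s) *
        ((∑ η, weight w η * condS w {s} X g (setCl (η \ B) X)) * ∑ η, weight w η * ind (sepEv N X) (η \ B)) := by
    rw [hT, ← hZ]; ring
  have rhs_eq : ∑ η, weight w η * K (openEdgeCluster ω s) (η \ B) =
      ind (avoidEv s X) ω * ind (hitN s N) (openEdgeCluster ω s) *
        ∑ η, weight w η * (condS w {s} X g (setCl (η \ B) X) * ind (sepEv N X) (η \ B)) := by
    simp only [hK, Finset.mul_sum]
    rw [ind_avoidEv_eq_cluster s X ω]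
    refine Finset.sum_congr rfl fun η _ => ?_
    ring
  rw [lhs_eq, rhs_eq]
  exact mul_le_mul_of_nonneg_left hH (mul_nonneg hNX0 hh0)

end TANWithin

end HullPort

end Summit.CriticalPhenomena.PercolationContinuityZ3.Theorems
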